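import Summits.Ventures.CertifiedManyBodySolver.Downfold.EmeryOrbitalWeight
import Summits.Ventures.CertifiedManyBodySolver.Downfold.EmerySecularFormDefectCheck
import HarnessLib

/-!
# The Cu-d weight ALONG THE WHOLE FERMI SURFACE of the σ three-band model, exactly: on one constant-energy contour `w_d(k)` is a
# Möbius function of `s = sin²(k_x/2) + sin²(k_y/2)`, hence lies between its nodal and antinodal values; the kernel-decidable point
# rule `dwCheck` (certified windows for `w_d(node)`, `w_d(antinode)` and the Fermi-surface hull) — the certified weight of the U leg

Venture CertifiedManyBodySolver, cell `pub/hubbard-downfold` (stage S1 = ROUTER; technique B = band level; INFLATION-RULES-3to1-B §B.4/§B.24: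
the U leg of the three-band → one-band reduction reads the three-band interactions through the Cu-d weight `w = a²` of the conduction
band, `EmeryBandLevelU.bandLevelU`), seat hubbard-downfold-mod-4; namespace `Summit.Ventures.CertifiedManyBodySolver.Downfold.Emery`.
Sequel of `EmeryOrbitalWeight` (`dWeight = minorD/(minorD + minorX + minorY)`, `= |ψ_d|²` of the contour eigenvector, `= minorD/∂_ε charCubic`;
`=` the Löwdin active weight by `EmeryLoewdinBridge.dWeight_eq_loewdinActiveWeight`) and of `EmerySecularFormDefectCheck` (the images
`isNode`, `iyFace`, `iPn`, `iPa` of the nodal sum, the face ordinate and the two energy denominators). Everything here is PROVED (0 sorry;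
exact algebra + the tree's rational interval arithmetic decided by the kernel). WHAT THIS IS NOT: a statement about any material (no number
lives here); `U = 0` one-body kinematics of the σ model AS PRINTED; not a cRPA or screening statement.

* §1 THE p-WEIGHT NUMERATOR IS AFFINE IN `s`: `minorX + minorY = pwA + pwB·(x + y)` IDENTICALLY, `pwA = 2ε(Δ + ε)`, `pwB = −4(t_pd² − t_pp′ε)`
  (`minorX_add_minorY`); so wherever `∂_ε charCubic ≠ 0`, `dWeight = 1 − (pwA + pwB·s)/∂_ε charCubic` (`dWeight_eq_one_sub_div`), and ON A
  CONTOUR (`∂_ε charCubic = dcharA + dcharB·s`, `EmeryFermiVelocityScale.dcharCubic_eq_affine`) the d-weight is the MÖBIUS function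
  `1 − (pwA + pwB·s)/(dcharA + dcharB·s)` of `s` alone (`dWeight_on_contour`).
* §3 CLOSED-FORM NODE AND ANTINODE of the `ε`-contour: `xNode = fsD1/(2fsN1)` (the zero of the d-sector quadratic `dQuad`, LINEAR in `x`;
  `charCubic_xNode`, uniqueness `eq_xNode_of_diag`) and `yFace = (cA − 4fsD)/(4fsD + 16fsN)` (`charCubic_yFace`, `eq_yFace_of_face`); on the zone
  contour (`fsD, fsN > 0`, `ε ≥ 0`, `0 ≤ x, y ≤ 1`) `2·xNode ≤ x + y ≤ 1 + yFace` (`sum_mem_Icc_xNode_yFace`, from `le_sum_of_contour` /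
  `sum_le_of_contour_face1` of `EmeryFermiVelocityScale`).
* §4 **THE THEOREM**: on one zone contour with positive energy denominator at `xNode` and at `yFace`, the energy denominator is positive at EVERY
  contour point and **the Cu-d weight of every Fermi-surface Bloch state lies between its nodal and its antinodal value**
  (`dWeight_mem_uIcc_of_contour`).
* §5 THE CHECKER `dwCheck Δ a b c e₁ e₂ wnlo wnhi walo wahi` (a plain conjunction of rational tests on interval images; inputs a σ point
  `(Δ_pd, t_pd, t_pp, t_pp′) ∈ ℚ⁴`, an energy piece `[e₁, e₂] ∋ ε_F`, claimed windows) with SOUNDNESS: for every `ε` in the piece —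
  `dWeight(node) ∈ [wnlo, wnhi]`, `dWeight(antinode) ∈ [walo, wahi]` at the closed-form points (`dWeight_nodeFace_of_dwCheck`) and at every nodal
  `(x_n, x_n)` / antinodal `(1, y_a)` contour point (`dWeight_of_dwCheck`, the `fdCheck` convention), and **for every zone Fermi point
  `w_d(k_F) ∈ [min wnlo walo, max wnhi wahi]`** (`dWeightFS_of_dwCheck`).

Composed with a set's certified ε_F bracket (`scalePt_…_br`) this words the certified Cu-d weight window of a typed σ set ON ITS OWN FERMI SURFACE.
Sources: [HybertsenSchluterChristensen1989, Eq. (1)]; [AndersenEtAl1995, §6]; interval arithmetic [folklore] (Moore 1966, Ch. 2–3).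
-/

noncomputable section

namespace Summit.Ventures.CertifiedManyBodySolver.Downfold.Emery

open Real Set NonemptyInterval

/-! ## §1 The p-weight numerator is affine in `s`; the d-weight on a contour is a Möbius function of `s` -/

/-- Constant coefficient of `minorX + minorY` in `s = x + y`: `pwA = 2ε(Δ + ε) = 2·fsD1`. [folklore] -/
def pwA (Δ ε : ℝ) : ℝ := 2 * fsD1 Δ ε

/-- Slope of `minorX + minorY` in `s = x + y`: `pwB = −4(t_pd² − t_pp′ε)`. [folklore] -/
def pwB (tpd c ε : ℝ) : ℝ := -4 * (tpd ^ 2 - c * ε)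

/-- **`minorX + minorY = pwA + pwB·(x + y)` identically** (no contour needed): the O-weight numerator of the contour eigenvector is
affine in `s`. [folklore] -/
theorem minorX_add_minorY (Δ tpd c x y ε : ℝ) :
    minorX Δ tpd c y ε + minorY Δ tpd c x ε = pwA Δ ε + pwB tpd c ε * (x + y) := by
  unfold minorX minorY pwA pwB fsD1
  ring

/-- `dWeight = 1 − (pwA + pwB·s)/∂_ε charCubic` wherever `∂_ε charCubic ≠ 0`. [folklore] -/
theorem dWeight_eq_one_sub_div {Δ tpd tpp c x y ε : ℝ} (h : dcharCubic Δ tpd tpp c x y ε ≠ 0) :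
    dWeight Δ tpd tpp c x y ε = 1 - (pwA Δ ε + pwB tpd c ε * (x + y)) / dcharCubic Δ tpd tpp c x y ε := by
  have hs := sum_minors_eq_dcharCubic Δ tpd tpp c x y ε
  rw [dWeight_eq_div_dcharCubic, eq_sub_iff_add_eq, ← minorX_add_minorY, ← add_div, ← add_assoc, hs, div_self h]

/-- **ON A CONTOUR the d-weight is a Möbius function of `s = x + y`**: `dWeight = 1 − (pwA + pwB·s)/(dcharA + dcharB·s)`. [folklore] -/
theorem dWeight_on_contour {Δ tpd tpp c x y ε : ℝ} (hN : fsN tpd tpp c ε ≠ 0) (hP : charCubic Δ tpd tpp c x y ε = 0)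
    (h : dcharCubic Δ tpd tpp c x y ε ≠ 0) :
    dWeight Δ tpd tpp c x y ε =
      1 - (pwA Δ ε + pwB tpd c ε * (x + y)) / (dcharA Δ tpd tpp c ε + dcharB Δ tpd tpp c ε * (x + y)) := by
  rw [dWeight_eq_one_sub_div h, dcharCubic_eq_affine hN hP]

/-! ## §2 Möbius functions between their endpoint values -/

/-- An affine function positive at both ends of an interval is positive on it. [folklore] -/
theorem affine_pos_of_ends {C D s s₁ s₂ : ℝ} (h₁ : 0 < C + D * s₁) (h₂ : 0 < C + D * s₂) (hs : s ∈ Set.Icc s₁ s₂) :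
    0 < C + D * s := by
  rcases le_total 0 D with hD | hD
  · have := mul_le_mul_of_nonneg_left hs.1 hD
    linarith
  · have := mul_le_mul_of_nonpos_left hs.2 hD
    linarith

/-- **A Möbius function `(A + Bs)/(C + Ds)` whose denominator is positive at both ends of `[s₁, s₂]` takes, on `[s₁, s₂]`, values between
its two endpoint values** (it is monotone: the sign of `BC − AD` decides which way). [folklore] -/
theorem moebius_mem_uIcc {A B C D s s₁ s₂ : ℝ} (h₁ : 0 < C + D * s₁) (h₂ : 0 < C + D * s₂) (hs : s ∈ Set.Icc s₁ s₂) :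
    (A + B * s) / (C + D * s) ∈ Set.uIcc ((A + B * s₁) / (C + D * s₁)) ((A + B * s₂) / (C + D * s₂)) := by
  have hP := affine_pos_of_ends h₁ h₂ hs
  have hP' := hP.ne'
  have h₁' := h₁.ne'
  have h₂' := h₂.ne'
  have e1 : (A + B * s) / (C + D * s) - (A + B * s₁) / (C + D * s₁) =
      (B * C - A * D) * (s - s₁) / ((C + D * s) * (C + D * s₁)) := by
    rw [div_sub_div _ _ hP' h₁']
    congr 1
    ring
  have e2 : (A + B * s₂) / (C + D * s₂) - (A + B * s) / (C + D * s) =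
      (B * C - A * D) * (s₂ - s) / ((C + D * s₂) * (C + D * s)) := by
    rw [div_sub_div _ _ h₂' hP']
    congr 1
    ring
  have hd1 : 0 < (C + D * s) * (C + D * s₁) := mul_pos hP h₁
  have hd2 : 0 < (C + D * s₂) * (C + D * s) := mul_pos h₂ hP
  have hs1 : 0 ≤ s - s₁ := sub_nonneg.2 hs.1; have hs2 : 0 ≤ s₂ - s := sub_nonneg.2 hs.2
  rcases le_total 0 (B * C - A * D) with hk | hk
  · have d1 : 0 ≤ (A + B * s) / (C + D * s) - (A + B * s₁) / (C + D * s₁) := by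
      rw [e1]; exact div_nonneg (mul_nonneg hk hs1) hd1.le
    have d2 : 0 ≤ (A + B * s₂) / (C + D * s₂) - (A + B * s) / (C + D * s) := by
      rw [e2]; exact div_nonneg (mul_nonneg hk hs2) hd2.le
    exact Set.mem_uIcc.2 (Or.inl ⟨by linarith, by linarith⟩)
  · have d1 : (A + B * s) / (C + D * s) - (A + B * s₁) / (C + D * s₁) ≤ 0 := by
      rw [e1]; exact div_nonpos_iff.2 (Or.inr ⟨mul_nonpos_iff.2 (Or.inr ⟨hk, hs1⟩), hd1.le⟩)
    have d2 : (A + B * s₂) / (C + D * s₂) - (A + B * s) / (C + D * s) ≤ 0 := by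
      rw [e2]; exact div_nonpos_iff.2 (Or.inr ⟨mul_nonpos_iff.2 (Or.inr ⟨hk, hs2⟩), hd2.le⟩)
    exact Set.mem_uIcc.2 (Or.inr ⟨by linarith, by linarith⟩)

/-! ## §3 Closed-form node and antinode of a contour; the `s`-range of the zone contour -/

/-- **The nodal abscissa of the `ε`-contour in closed form**: `xNode = fsD1/(2·fsN1) = ε(Δ + ε)/(8t_pd² + 4ε(t_pp − t_pp′))` — the zero of the
d-sector quadratic `dQuad` of the diagonal factorisation (`EmeryBilayerMirror.charCubic_diag`), which is LINEAR in `x`. [cite: AndersenEtAl1995, Eq. (24)] -/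
def xNode (Δ tpd tpp c ε : ℝ) : ℝ := fsD1 Δ ε / (2 * fsN1 tpd tpp c ε)

/-- `dQuad = fsD1 − 2·fsN1·x`. [folklore] -/
theorem dQuad_eq_fsD1_sub (Δ tpd tpp c x ε : ℝ) : dQuad Δ tpd tpp c x ε = fsD1 Δ ε - 2 * fsN1 tpd tpp c ε * x := by
  unfold dQuad fsD1 fsN1
  ring

/-- `(xNode, xNode)` lies on the `ε`-contour (whenever `fsN1 ≠ 0`). [folklore] -/
theorem charCubic_xNode {Δ tpd tpp c ε : ℝ} (hN1 : fsN1 tpd tpp c ε ≠ 0) :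
    charCubic Δ tpd tpp c (xNode Δ tpd tpp c ε) (xNode Δ tpd tpp c ε) ε = 0 := by
  have hq : dQuad Δ tpd tpp c (xNode Δ tpd tpp c ε) ε = 0 := by
    rw [dQuad_eq_fsD1_sub, xNode]
    field_simp
    ring
  rw [charCubic_diag, hq, mul_zero]

/-- Uniqueness of the node: a diagonal contour point `(x, x)` with `Δ + ε > 0`, `t_pp + t_pp′ ≥ 0`, `x ≥ 0` IS `xNode`. [folklore] -/
theorem eq_xNode_of_diag {Δ tpd tpp c x ε : ℝ} (hΔε : 0 < Δ + ε) (hct : 0 ≤ c + tpp) (hx : 0 ≤ x)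
    (hN1 : fsN1 tpd tpp c ε ≠ 0) (hP : charCubic Δ tpd tpp c x x ε = 0) : x = xNode Δ tpd tpp c ε := by
  obtain ⟨h2x, -⟩ := axialLin_node_eq_zero hΔε hct hx hP
  unfold xNode
  rw [eq_div_iff (mul_ne_zero two_ne_zero hN1)]
  linarith

/-- `2·xNode = fsD1/fsN1` (the nodal sum `s_node`). [folklore] -/
theorem two_xNode {Δ tpd tpp c ε : ℝ} (hN1 : fsN1 tpd tpp c ε ≠ 0) :
    xNode Δ tpd tpp c ε + xNode Δ tpd tpp c ε = fsD1 Δ ε / fsN1 tpd tpp c ε := by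
  unfold xNode
  field_simp
  ring

/-- **The antinodal (zone-face) ordinate of the `ε`-contour in closed form**: `yFace = (cA − 4fsD)/(4fsD + 16fsN)` (the contour is bilinear,
so the face point solves a LINEAR equation). [folklore] -/
def yFace (Δ tpd tpp c ε : ℝ) : ℝ := (cA Δ ε - 4 * fsD Δ tpd c ε) / (4 * fsD Δ tpd c ε + 16 * fsN tpd tpp c ε)

/-- `(1, yFace)` lies on the `ε`-contour (whenever `4fsD + 16fsN ≠ 0`). [folklore] -/
theorem charCubic_yFace {Δ tpd tpp c ε : ℝ} (hF : 4 * fsD Δ tpd c ε + 16 * fsN tpd tpp c ε ≠ 0) :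
    charCubic Δ tpd tpp c 1 (yFace Δ tpd tpp c ε) ε = 0 := by
  rw [charCubic_bilinear, yFace]
  field_simp
  ring

/-- Uniqueness of the antinode: a face contour point `(1, y)` IS `yFace`. [folklore] -/
theorem eq_yFace_of_face {Δ tpd tpp c y ε : ℝ} (hF : 4 * fsD Δ tpd c ε + 16 * fsN tpd tpp c ε ≠ 0)
    (hP : charCubic Δ tpd tpp c 1 y ε = 0) : y = yFace Δ tpd tpp c ε := by
  rw [charCubic_bilinear] at hP
  unfold yFace
  rw [eq_div_iff hF]
  linarith

/-- **THE `s`-RANGE OF A ZONE CONTOUR**: in the cuprate regime (`fsD, fsN > 0`, `ε ≥ 0`) every contour point with `0 ≤ x, y ≤ 1` has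
`2·xNode ≤ x + y ≤ 1 + yFace` (nodal minimum by AM–GM on the hyperbola `(4fsN·x + fsD)(4fsN·y + fsD) = fsK`; antinodal maximum on the face
`x = 1`). [folklore] -/
theorem sum_mem_Icc_xNode_yFace {Δ tpd tpp c x y ε : ℝ} (hN : 0 < fsN tpd tpp c ε) (hD : 0 < fsD Δ tpd c ε) (hε : 0 ≤ ε)
    (hN1 : fsN1 tpd tpp c ε ≠ 0) (hx : x ∈ Set.Icc (0 : ℝ) 1) (hy : y ∈ Set.Icc (0 : ℝ) 1)
    (hP : charCubic Δ tpd tpp c x y ε = 0) :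
    x + y ∈ Set.Icc (xNode Δ tpd tpp c ε + xNode Δ tpd tpp c ε) (1 + yFace Δ tpd tpp c ε) := by
  constructor
  · apply le_sum_of_contour hN hD hx.1 hy.1 hP
    have h := contour_hyperbola (charCubic_xNode (Δ := Δ) hN1)
    have e : fsD Δ tpd c ε + 2 * fsN tpd tpp c ε * (xNode Δ tpd tpp c ε + xNode Δ tpd tpp c ε) =
        4 * fsN tpd tpp c ε * xNode Δ tpd tpp c ε + fsD Δ tpd c ε := by ring
    rw [e, sq]
    exact h.le
  · have h := sum_le_of_contour_face1 hN hD hε hx.1 hy.1 hx.2 hy.2 hP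
    have e : 16 * fsN tpd tpp c ε + 4 * fsD Δ tpd c ε = 4 * fsD Δ tpd c ε + 16 * fsN tpd tpp c ε := by ring
    unfold yFace
    rw [← e]
    exact h

/-! ## §4 The theorem: along one Fermi contour the Cu-d weight lies between its nodal and antinodal values -/

/-- **ALONG ONE ZONE CONTOUR THE Cu-d WEIGHT OF THE BLOCH STATE LIES BETWEEN ITS NODAL AND ITS ANTINODAL VALUE**, and the energy
denominator is positive at every contour point once it is positive at `xNode` and at `yFace` (cuprate regime `fsD, fsN > 0`, `ε ≥ 0`,
`fsN1 ≠ 0`; `0 ≤ x, y ≤ 1`). [folklore] -/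
theorem dWeight_mem_uIcc_of_contour {Δ tpd tpp c x y ε : ℝ} (hN : 0 < fsN tpd tpp c ε) (hD : 0 < fsD Δ tpd c ε) (hε : 0 ≤ ε)
    (hN1 : fsN1 tpd tpp c ε ≠ 0)
    (hWn : 0 < dcharCubic Δ tpd tpp c (xNode Δ tpd tpp c ε) (xNode Δ tpd tpp c ε) ε)
    (hWa : 0 < dcharCubic Δ tpd tpp c 1 (yFace Δ tpd tpp c ε) ε)
    (hx : x ∈ Set.Icc (0 : ℝ) 1) (hy : y ∈ Set.Icc (0 : ℝ) 1) (hP : charCubic Δ tpd tpp c x y ε = 0) :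
    0 < dcharCubic Δ tpd tpp c x y ε ∧
      dWeight Δ tpd tpp c x y ε ∈
        Set.uIcc (dWeight Δ tpd tpp c (xNode Δ tpd tpp c ε) (xNode Δ tpd tpp c ε) ε) (dWeight Δ tpd tpp c 1 (yFace Δ tpd tpp c ε) ε) := by
  have hF : 4 * fsD Δ tpd c ε + 16 * fsN tpd tpp c ε ≠ 0 := by positivity
  have hPn := charCubic_xNode (Δ := Δ) hN1
  have hPa := charCubic_yFace hF
  have hs := sum_mem_Icc_xNode_yFace hN hD hε hN1 hx hy hP
  have hWn0 := hWn.ne'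
  have hWa0 := hWa.ne'
  rw [dcharCubic_eq_affine hN.ne' hPn] at hWn
  rw [dcharCubic_eq_affine hN.ne' hPa] at hWa
  have hWs : 0 < dcharCubic Δ tpd tpp c x y ε := by
    rw [dcharCubic_eq_affine hN.ne' hP]
    exact affine_pos_of_ends hWn hWa hs
  refine ⟨hWs, ?_⟩
  have hm := moebius_mem_uIcc (A := pwA Δ ε) (B := pwB tpd c ε) hWn hWa hs
  rw [dWeight_on_contour hN.ne' hP hWs.ne', dWeight_on_contour hN.ne' hPn hWn0, dWeight_on_contour hN.ne' hPa hWa0]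
  rcases Set.mem_uIcc.1 hm with ⟨h1, h2⟩ | ⟨h1, h2⟩
  · exact Set.mem_uIcc.2 (Or.inr ⟨by linarith, by linarith⟩)
  · exact Set.mem_uIcc.2 (Or.inl ⟨by linarith, by linarith⟩)

/-! ## §5 Interval images, the checker `dwCheck`, soundness -/

/-- Image of `pwA = 2·fsD1`. [folklore] -/
def ipwA (IΔ Ie : NonemptyInterval ℚ) : NonemptyInterval ℚ := iscale 2 (ifsD1 IΔ Ie)

/-- Image of `pwB = (−4)·(t_pd² − t_pp′ε)`. [folklore] -/
def ipwB (Ia Ic Ie : NonemptyInterval ℚ) : NonemptyInterval ℚ := iscale (-4) (Ia.moorePow 2 - Ic.mooreMul Ie)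

/-- Image of the O-weight numerator at the node, `pwA + pwB·s_node`. [folklore] -/
def ipwNode (IΔ Ia Ib Ic Ie : NonemptyInterval ℚ) : NonemptyInterval ℚ :=
  ipwA IΔ Ie + (ipwB Ia Ic Ie).mooreMul (isNode IΔ Ia Ib Ic Ie)

/-- Image of the O-weight numerator at the antinode, `pwA + pwB·(1 + y_a)`. [folklore] -/
def ipwFace (IΔ Ia Ib Ic Ie : NonemptyInterval ℚ) : NonemptyInterval ℚ :=
  ipwA IΔ Ie + (ipwB Ia Ic Ie).mooreMul (NonemptyInterval.pure 1 + iyFace IΔ Ia Ib Ic Ie)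

/-- Image of the nodal d-weight `1 − pNode/∂_ε charCubic(node)`. [folklore] -/
def idwNode (IΔ Ia Ib Ic Ie : NonemptyInterval ℚ) : NonemptyInterval ℚ :=
  NonemptyInterval.pure 1 - idivPos (ipwNode IΔ Ia Ib Ic Ie) (iPn IΔ Ia Ib Ic Ie)

/-- Image of the antinodal d-weight `1 − pFace/∂_ε charCubic(antinode)`. [folklore] -/
def idwFace (IΔ Ia Ib Ic Ie : NonemptyInterval ℚ) : NonemptyInterval ℚ :=
  NonemptyInterval.pure 1 - idivPos (ipwFace IΔ Ia Ib Ic Ie) (iPa IΔ Ia Ib Ic Ie)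

/-- **`dwCheck`** — the kernel-decidable point rule for the Fermi-surface Cu-d weight. Inputs: a σ one-body point
`(Δ, a, b, c) = (Δ_pd, t_pd, t_pp, t_pp′)`, an energy piece `[e₁, e₂]` (`e₁, e₂ > 0`), claimed windows `[wnlo, wnhi] ∋ w_d(node)`,
`[walo, wahi] ∋ w_d(antinode)`. A plain conjunction of rational tests. [folklore] -/
def dwCheck (Δ a b c e₁ e₂ wnlo wnhi walo wahi : ℚ) : Bool :=
  let IΔ := ihull Δ Δ
  let Ia := ihull a a
  let Ib := ihull b b
  let Ic := ihull c c
  let Ie := ihull e₁ e₂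
  decide (0 < min e₁ e₂) && decide (0 < Δ + min e₁ e₂) && decide (0 ≤ c + b) &&
  decide (0 < (ifsN Ia Ib Ic Ie).fst) && decide (0 < (ifsD IΔ Ia Ic Ie).fst) &&
  decide (0 < (ifsD1 IΔ Ie).fst) && decide (0 < (ifsN1 Ia Ib Ic Ie).fst) && decide (0 ≤ (icA IΔ Ie).fst) &&
  decide (0 < (iFaceDen IΔ Ia Ib Ic Ie).fst) && decide (0 < (iPn IΔ Ia Ib Ic Ie).fst) && decide (0 < (iPa IΔ Ia Ib Ic Ie).fst) &&
  decide (wnlo ≤ (idwNode IΔ Ia Ib Ic Ie).fst) && decide ((idwNode IΔ Ia Ib Ic Ie).snd ≤ wnhi) &&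
  decide (walo ≤ (idwFace IΔ Ia Ib Ic Ie).fst) && decide ((idwFace IΔ Ia Ib Ic Ie).snd ≤ wahi)

/-- **SOUNDNESS of `dwCheck` at the closed-form points.** For every `ε` in the piece: the regime facts (`fsN, fsD > 0`, `ε ≥ 0`, `fsN1 ≠ 0`,
`Δ + ε > 0`, `t_pp + t_pp′ ≥ 0`), positive energy denominators at `(xNode, xNode)` and `(1, yFace)`, and the two windows
`dWeight(xNode, xNode) ∈ [wnlo, wnhi]`, `dWeight(1, yFace) ∈ [walo, wahi]`. [folklore] -/
theorem dWeight_nodeFace_of_dwCheck {Δ a b c e₁ e₂ wnlo wnhi walo wahi : ℚ} (h : dwCheck Δ a b c e₁ e₂ wnlo wnhi walo wahi = true)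
    {ε : ℝ} (he : ε ∈ Set.Icc (e₁ : ℝ) e₂) :
    0 < fsN (a : ℝ) b c ε ∧ 0 < fsD (Δ : ℝ) a c ε ∧ 0 ≤ ε ∧ fsN1 (a : ℝ) b c ε ≠ 0 ∧ 0 < (Δ : ℝ) + ε ∧ 0 ≤ (c : ℝ) + b ∧
      0 < dcharCubic (Δ : ℝ) a b c (xNode (Δ : ℝ) a b c ε) (xNode (Δ : ℝ) a b c ε) ε ∧
      0 < dcharCubic (Δ : ℝ) a b c 1 (yFace (Δ : ℝ) a b c ε) ε ∧
      dWeight (Δ : ℝ) a b c (xNode (Δ : ℝ) a b c ε) (xNode (Δ : ℝ) a b c ε) ε ∈ Set.Icc (wnlo : ℝ) wnhi ∧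
      dWeight (Δ : ℝ) a b c 1 (yFace (Δ : ℝ) a b c ε) ε ∈ Set.Icc (walo : ℝ) wahi := by
  simp only [dwCheck, Bool.and_eq_true, decide_eq_true_eq] at h
  obtain ⟨⟨⟨⟨⟨⟨⟨⟨⟨⟨⟨⟨⟨⟨he0, hΔe⟩, hcb⟩, hNq⟩, hDq⟩, hD1q⟩, hN1q⟩, hAq⟩, hFq⟩, hPnq⟩, hPaq⟩, hnlo⟩, hnhi⟩, halo⟩, hahi⟩ := h
  obtain ⟨mcA, mD, mN, -, mdcA, mdD, mdN⟩ :=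
    mem_images (mem_Icc_self_cast Δ) (mem_Icc_self_cast a) (mem_Icc_self_cast b) (mem_Icc_self_cast c) he
  have mΔ := mem_ihull (mem_Icc_self_cast Δ)
  have ma := mem_ihull (mem_Icc_self_cast a)
  have mc := mem_ihull (mem_Icc_self_cast c)
  have mb := mem_ihull (mem_Icc_self_cast b)
  have me := mem_ihull he
  have m1 : (1 : ℝ) ∈ (NonemptyInterval.pure (1 : ℚ)).ratCast ℝ := mem_pure_of_cast_eq (by norm_num)
  have m2 : (2 : ℝ) ∈ (NonemptyInterval.pure (2 : ℚ)).ratCast ℝ := mem_pure_of_cast_eq (by norm_num)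
  have m4 : (4 : ℝ) ∈ (NonemptyInterval.pure (4 : ℚ)).ratCast ℝ := mem_pure_of_cast_eq (by norm_num)
  have mD1 : fsD1 (Δ : ℝ) ε ∈ (ifsD1 (ihull Δ Δ) (ihull e₁ e₂)).ratCast ℝ := by
    unfold fsD1 ifsD1; exact mem_ratCast_mul me (mem_ratCast_add mΔ me)
  have mN1 : fsN1 (a : ℝ) b c ε ∈ (ifsN1 (ihull a a) (ihull b b) (ihull c c) (ihull e₁ e₂)).ratCast ℝ := by
    unfold fsN1 ifsN1
    exact mem_ratCast_add (mem_ratCast_mul m4 (mem_ratCast_sq ma)) (mem_ratCast_mul (mem_ratCast_mul m2 me) (mem_ratCast_sub mb mc))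
  -- real regime facts
  have hN : 0 < fsN (a : ℝ) b c ε := lt_of_lt_of_le (by exact_mod_cast hNq) (mem_ratCast_iff.mp mN).1
  have hD : 0 < fsD (Δ : ℝ) a c ε := lt_of_lt_of_le (by exact_mod_cast hDq) (mem_ratCast_iff.mp mD).1
  have hD1 : 0 < fsD1 (Δ : ℝ) ε := lt_of_lt_of_le (by exact_mod_cast hD1q) (mem_ratCast_iff.mp mD1).1
  have hN1 : 0 < fsN1 (a : ℝ) b c ε := lt_of_lt_of_le (by exact_mod_cast hN1q) (mem_ratCast_iff.mp mN1).1
  have hε0 : ((min e₁ e₂ : ℚ) : ℝ) ≤ ε := (mem_ratCast_iff.mp me).1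
  have hε : 0 ≤ ε := le_trans (le_of_lt (by exact_mod_cast he0)) hε0
  have hΔε : 0 < (Δ : ℝ) + ε := by
    have h1 : (0 : ℝ) < (Δ : ℝ) + ((min e₁ e₂ : ℚ) : ℝ) := by exact_mod_cast hΔe
    linarith
  have hct : 0 ≤ (c : ℝ) + b := by exact_mod_cast hcb
  -- the node
  have hPn := charCubic_xNode (Δ := (Δ : ℝ)) hN1.ne'
  have msn : xNode (Δ : ℝ) a b c ε + xNode (Δ : ℝ) a b c ε ∈
      (isNode (ihull Δ Δ) (ihull a a) (ihull b b) (ihull c c) (ihull e₁ e₂)).ratCast ℝ := by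
    rw [two_xNode hN1.ne']; unfold isNode; exact mem_idivPos hN1q mD1 mN1
  -- the face
  have m4D : (4 : ℝ) * fsD (Δ : ℝ) a c ε ∈ (iscale 4 (ifsD (ihull Δ Δ) (ihull a a) (ihull c c) (ihull e₁ e₂))).ratCast ℝ := by
    have := mem_iscale 4 mD; push_cast at this; exact this
  have m16N : (16 : ℝ) * fsN (a : ℝ) b c ε ∈ (iscale 16 (ifsN (ihull a a) (ihull b b) (ihull c c) (ihull e₁ e₂))).ratCast ℝ := by
    have := mem_iscale 16 mN; push_cast at this; exact this
  have mFden : 4 * fsD (Δ : ℝ) a c ε + 16 * fsN (a : ℝ) b c ε ∈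
      (iFaceDen (ihull Δ Δ) (ihull a a) (ihull b b) (ihull c c) (ihull e₁ e₂)).ratCast ℝ := by
    unfold iFaceDen; exact mem_ratCast_add m4D m16N
  have hF : 4 * fsD (Δ : ℝ) a c ε + 16 * fsN (a : ℝ) b c ε ≠ 0 := by positivity
  have hPa := charCubic_yFace (Δ := (Δ : ℝ)) (tpp := (b : ℝ)) hF
  have mya : yFace (Δ : ℝ) a b c ε ∈ (iyFace (ihull Δ Δ) (ihull a a) (ihull b b) (ihull c c) (ihull e₁ e₂)).ratCast ℝ := by
    unfold yFace iyFace; exact mem_idivPos hFq (mem_ratCast_sub mcA m4D) mFden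
  have m1ya : 1 + yFace (Δ : ℝ) a b c ε ∈
      (NonemptyInterval.pure 1 + iyFace (ihull Δ Δ) (ihull a a) (ihull b b) (ihull c c) (ihull e₁ e₂)).ratCast ℝ :=
    mem_ratCast_add m1 mya
  -- affine coefficients of the energy denominator
  have mA : dcharA (Δ : ℝ) a b c ε ∈
      (idcharA (ihull Δ Δ) (ihull a a) (ihull b b) (ihull c c) (ihull e₁ e₂)).ratCast ℝ := by
    unfold dcharA idcharA
    exact mem_ratCast_sub mdcA (mem_idivPos hNq (mem_ratCast_mul mdN mcA) mN)
  have mB : dcharB (Δ : ℝ) a b c ε ∈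
      (idcharB (ihull Δ Δ) (ihull a a) (ihull b b) (ihull c c) (ihull e₁ e₂)).ratCast ℝ := by
    unfold dcharB idcharB
    have mneg4 := mem_iscale (-4) mdD
    push_cast at mneg4
    exact mem_ratCast_add mneg4 (mem_idivPos hNq (mem_ratCast_mul m4D mdN) mN)
  have mPn : dcharCubic (Δ : ℝ) a b c (xNode (Δ : ℝ) a b c ε) (xNode (Δ : ℝ) a b c ε) ε ∈
      (iPn (ihull Δ Δ) (ihull a a) (ihull b b) (ihull c c) (ihull e₁ e₂)).ratCast ℝ := by
    rw [dcharCubic_eq_affine hN.ne' hPn]; unfold iPn; exact mem_ratCast_add mA (mem_ratCast_mul mB msn)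
  have mPa : dcharCubic (Δ : ℝ) a b c 1 (yFace (Δ : ℝ) a b c ε) ε ∈
      (iPa (ihull Δ Δ) (ihull a a) (ihull b b) (ihull c c) (ihull e₁ e₂)).ratCast ℝ := by
    rw [dcharCubic_eq_affine hN.ne' hPa]; unfold iPa; exact mem_ratCast_add mA (mem_ratCast_mul mB m1ya)
  have hWn : 0 < dcharCubic (Δ : ℝ) a b c (xNode (Δ : ℝ) a b c ε) (xNode (Δ : ℝ) a b c ε) ε :=
    lt_of_lt_of_le (by exact_mod_cast hPnq) (mem_ratCast_iff.mp mPn).1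
  have hWa : 0 < dcharCubic (Δ : ℝ) a b c 1 (yFace (Δ : ℝ) a b c ε) ε :=
    lt_of_lt_of_le (by exact_mod_cast hPaq) (mem_ratCast_iff.mp mPa).1
  -- the O-weight numerators
  have mpA : pwA (Δ : ℝ) ε ∈ (ipwA (ihull Δ Δ) (ihull e₁ e₂)).ratCast ℝ := by
    have := mem_iscale 2 mD1; push_cast at this; unfold pwA ipwA; exact this
  have mpB : pwB (a : ℝ) c ε ∈ (ipwB (ihull a a) (ihull c c) (ihull e₁ e₂)).ratCast ℝ := by
    have := mem_iscale (-4) (mem_ratCast_sub (mem_ratCast_sq ma) (mem_ratCast_mul mc me))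
    push_cast at this; unfold pwB ipwB; exact this
  have mpn : pwA (Δ : ℝ) ε + pwB (a : ℝ) c ε * (xNode (Δ : ℝ) a b c ε + xNode (Δ : ℝ) a b c ε) ∈
      (ipwNode (ihull Δ Δ) (ihull a a) (ihull b b) (ihull c c) (ihull e₁ e₂)).ratCast ℝ := by
    unfold ipwNode; exact mem_ratCast_add mpA (mem_ratCast_mul mpB msn)
  have mpa : pwA (Δ : ℝ) ε + pwB (a : ℝ) c ε * (1 + yFace (Δ : ℝ) a b c ε) ∈
      (ipwFace (ihull Δ Δ) (ihull a a) (ihull b b) (ihull c c) (ihull e₁ e₂)).ratCast ℝ := by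
    unfold ipwFace; exact mem_ratCast_add mpA (mem_ratCast_mul mpB m1ya)
  -- the two windows
  have mwn : dWeight (Δ : ℝ) a b c (xNode (Δ : ℝ) a b c ε) (xNode (Δ : ℝ) a b c ε) ε ∈
      (idwNode (ihull Δ Δ) (ihull a a) (ihull b b) (ihull c c) (ihull e₁ e₂)).ratCast ℝ := by
    rw [dWeight_eq_one_sub_div hWn.ne']; unfold idwNode; exact mem_ratCast_sub m1 (mem_idivPos hPnq mpn mPn)
  have mwa : dWeight (Δ : ℝ) a b c 1 (yFace (Δ : ℝ) a b c ε) ε ∈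
      (idwFace (ihull Δ Δ) (ihull a a) (ihull b b) (ihull c c) (ihull e₁ e₂)).ratCast ℝ := by
    rw [dWeight_eq_one_sub_div hWa.ne']; unfold idwFace; exact mem_ratCast_sub m1 (mem_idivPos hPaq mpa mPa)
  rw [mem_ratCast_iff] at mwn mwa
  refine ⟨hN, hD, hε, hN1.ne', hΔε, hct, hWn, hWa, ⟨?_, ?_⟩, ⟨?_, ?_⟩⟩
  · exact le_trans (by exact_mod_cast hnlo) mwn.1
  · exact mwn.2.trans (by exact_mod_cast hnhi)
  · exact le_trans (by exact_mod_cast halo) mwa.1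
  · exact mwa.2.trans (by exact_mod_cast hahi)

/-- **SOUNDNESS of `dwCheck`, `fdCheck` convention.** For every `ε` in the piece and every nodal `(x_n, x_n)` (`x_n ≥ 0`) and antinodal
`(1, y_a)` point of the contour at `ε`: positive energy denominators and `dWeight(node) ∈ [wnlo, wnhi]`, `dWeight(antinode) ∈ [walo, wahi]`.
[folklore] -/
theorem dWeight_of_dwCheck {Δ a b c e₁ e₂ wnlo wnhi walo wahi : ℚ} (h : dwCheck Δ a b c e₁ e₂ wnlo wnhi walo wahi = true)
    {ε xn ya : ℝ} (he : ε ∈ Set.Icc (e₁ : ℝ) e₂) (hxn : 0 ≤ xn)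
    (hPn : charCubic (Δ : ℝ) a b c xn xn ε = 0) (hPa : charCubic (Δ : ℝ) a b c 1 ya ε = 0) :
    0 < dcharCubic (Δ : ℝ) a b c xn xn ε ∧ 0 < dcharCubic (Δ : ℝ) a b c 1 ya ε ∧
      dWeight (Δ : ℝ) a b c xn xn ε ∈ Set.Icc (wnlo : ℝ) wnhi ∧ dWeight (Δ : ℝ) a b c 1 ya ε ∈ Set.Icc (walo : ℝ) wahi := by
  obtain ⟨hN, hD, -, hN1, hΔε, hct, hWn, hWa, hwn, hwa⟩ := dWeight_nodeFace_of_dwCheck h he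
  have hF : 4 * fsD (Δ : ℝ) a c ε + 16 * fsN (a : ℝ) b c ε ≠ 0 := by positivity
  have hx := eq_xNode_of_diag hΔε hct hxn hN1 hPn
  have hy := eq_yFace_of_face hF hPa
  subst hx hy
  exact ⟨hWn, hWa, hwn, hwa⟩

/-- **SOUNDNESS of `dwCheck` ON THE WHOLE FERMI SURFACE.** For every `ε` in the piece and EVERY zone contour point `(x, y) ∈ [0, 1]²` at `ε`:
the energy denominator is positive and **the Cu-d weight of the Bloch state lies in the hull of the two windows,
`w_d(k_F) ∈ [min wnlo walo, max wnhi wahi]`**. [folklore] -/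
theorem dWeightFS_of_dwCheck {Δ a b c e₁ e₂ wnlo wnhi walo wahi : ℚ} (h : dwCheck Δ a b c e₁ e₂ wnlo wnhi walo wahi = true)
    {ε x y : ℝ} (he : ε ∈ Set.Icc (e₁ : ℝ) e₂) (hx : x ∈ Set.Icc (0 : ℝ) 1) (hy : y ∈ Set.Icc (0 : ℝ) 1)
    (hP : charCubic (Δ : ℝ) a b c x y ε = 0) :
    0 < dcharCubic (Δ : ℝ) a b c x y ε ∧
      dWeight (Δ : ℝ) a b c x y ε ∈ Set.Icc (min (wnlo : ℝ) walo) (max (wnhi : ℝ) wahi) := by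
  obtain ⟨hN, hD, hε, hN1, -, -, hWn, hWa, hwn, hwa⟩ := dWeight_nodeFace_of_dwCheck h he
  obtain ⟨hW, hm⟩ := dWeight_mem_uIcc_of_contour hN hD hε hN1 hWn hWa hx hy hP
  refine ⟨hW, ?_⟩
  rcases Set.mem_uIcc.1 hm with ⟨h1, h2⟩ | ⟨h1, h2⟩
  · exact ⟨(min_le_left _ _).trans (hwn.1.trans h1), h2.trans (hwa.2.trans (le_max_right _ _))⟩
  · exact ⟨(min_le_right _ _).trans (hwa.1.trans h1), h2.trans (hwn.2.trans (le_max_left _ _))⟩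

end Summit.Ventures.CertifiedManyBodySolver.Downfold.Emery
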